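import Mathlib
import Literature.Computability.Complexity.CircuitDAG
import Literature.Computability.Complexity.SymmetricDnf
import Summits.PneNP.PneNP.Theorems.SymmetryBudgetHamCompilesRankKey

/-!
# The rank gadget: an open `Bud(m,g)`-symmetric sub-circuit computing classes and ranks
# (stub `stub_symmetricA`, line `kotzig-cutspan`, crux `SymmetryBudget.HamCompiles`,
# stmt-PneNP-10637)

An OPEN gadget (gate type `RΛ m`, gate functions `rfn`, wires `rargs` into
`(Fin m × Fin m) ⊕ RΛ m`, a layer function `rlayer` strictly decreasing along wires) to be
embedded in labelled DAGs (`GateDAG`, `CircuitDAG.lean`), with explicit semantics `rsem m x`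
satisfying the GATE EQUATIONS (`rsem_eq`) and characterised by them (`eq_rsem`):

* `adj u a` computes `[a ∈ cls m x u]`, `free u` the constant `[u ∈ F]`,
* `lt u' u` computes `[key (cls u') < key (cls u)]` (one comparator of the two adjacency rows
  over the anchored columns, most significant index first; `key_lt_key_iff`),
* `r k u` computes `[k ≤ rk m x u]` (`k ≤ g`) by the rank recursion `succ_le_rk_iff`
  (`r (k+1) u = ⋁_{u'} (free u' ∧ lt u' u ∧ r k u')`), and `eqrank i u` computes
  `[rk m x u = i]`.

All gates are in `acBasis` (`rfn_mem_acBasis`). The action of the budget on the gadget and its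
size bound are in `SymmetryBudgetHamCompilesRankGadgetSymm.lean`.
-/

-- `Summit.PneNP.PneNP.…` duplicates `PneNP` BY DESIGN (single-problem summit, D-0017).
set_option linter.dupNamespace false

noncomputable section

namespace Summit.PneNP.PneNP.Theorems.HamCompilesKC

open Literature.Computability.Complexity
open Finset

namespace SymA

variable {m : ℕ}

/-! ### Gate labels, gate functions, wires -/

/-- Gate labels of the rank gadget (vertex indices `u, u', a : Fin m`, levels `k ≤ g`,
ranks `i < g`). -/
inductive RΛ (m : ℕ) : Type
  /-- the constant `true` -/
  | one : RΛ m
  /-- the constant `[u is free]` -/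
  | free (u : Fin m) : RΛ m
  /-- the constant `[a anchored ∧ u ≠ a]` -/
  | ane (u a : Fin m) : RΛ m
  /-- `x(u,a) ∨ x(a,u)` -/
  | e (u a : Fin m) : RΛ m
  /-- `[a ∈ cls u]` -/
  | adj (u a : Fin m) : RΛ m
  /-- `[a ∉ cls u]` -/
  | nadj (u a : Fin m) : RΛ m
  /-- `[a ∈ cls u ∧ a ∈ cls u']` -/
  | both (u u' a : Fin m) : RΛ m
  /-- `[a ∉ cls u ∧ a ∉ cls u']` -/
  | neither (u u' a : Fin m) : RΛ m
  /-- `[a ∈ cls u ↔ a ∈ cls u']` -/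
  | xnor (u u' a : Fin m) : RΛ m
  /-- the rows of `u`, `u'` agree above the anchored index `a` -/
  | hieq (u u' a : Fin m) : RΛ m
  /-- `a` witnesses `key (cls u') < key (cls u)` -/
  | wit (u' u a : Fin m) : RΛ m
  /-- `[key (cls u') < key (cls u)]` -/
  | lt (u' u : Fin m) : RΛ m
  /-- `[k ≤ rk u]` -/
  | r (k : Fin (gOf m + 1)) (u : Fin m) : RΛ m
  /-- `[u' free ∧ key (cls u') < key (cls u) ∧ k ≤ rk u']` -/
  | step (k : Fin (gOf m)) (u' u : Fin m) : RΛ m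
  /-- `[rk u < i + 1]` -/
  | nr (i : Fin (gOf m)) (u : Fin m) : RΛ m
  /-- `[rk u = i]` -/
  | eqrank (i : Fin (gOf m)) (u : Fin m) : RΛ m

/-- The gate labels form a finite type (via the proxy sum-of-products type). -/
instance instFintypeRΛ (m : ℕ) : Fintype (RΛ m) := Fintype.ofEquiv _ (proxy_equiv% (RΛ m))

/-- Wires of the gadget: matrix inputs or gadget gates. -/
abbrev RWire (m : ℕ) : Type := (Fin m × Fin m) ⊕ RΛ m

/-- Gate functions of the gadget (all in `acBasis`). -/
def rfn : RΛ m → GateFn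
  | .one => GateFn.and 0
  | .free u => GateFn.const (decide (¬ IsAnch m u))
  | .ane u a => GateFn.const (decide (IsAnch m a ∧ u ≠ a))
  | .e _ _ => GateFn.or 2
  | .adj _ _ => GateFn.and 2
  | .nadj _ _ => GateFn.not
  | .both _ _ _ => GateFn.and 2
  | .neither _ _ _ => GateFn.and 2
  | .xnor _ _ _ => GateFn.or 2
  | .hieq _ _ _ => GateFn.and m
  | .wit _ _ _ => GateFn.and 3
  | .lt _ _ => GateFn.or m
  | .r _ _ => GateFn.or m
  | .step _ _ _ => GateFn.and 3
  | .nr _ _ => GateFn.not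
  | .eqrank _ _ => GateFn.and 2

/-- Arity of `∧ₖ`. -/
@[simp] theorem and_fst (k : ℕ) : (GateFn.and k).1 = k := rfl
/-- Arity of `∨ₖ`. -/
@[simp] theorem or_fst (k : ℕ) : (GateFn.or k).1 = k := rfl
/-- Arity of `¬`. -/
@[simp] theorem not_fst : GateFn.not.1 = 1 := rfl
/-- Arity of a constant gate. -/
@[simp] theorem const_fst (b : Bool) : (GateFn.const b).1 = 0 := rfl

/-- The wires of the level-`k` rank gate `r k u`: at level `0` the constant `true`, at level
`k + 1` the step gates `step k u' u`. -/
def rPrev (u : Fin m) : Fin (gOf m + 1) → Fin m → RWire m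
  | ⟨0, _⟩, _ => Sum.inr .one
  | ⟨k + 1, h⟩, u' => Sum.inr (.step ⟨k, Nat.lt_of_succ_lt_succ h⟩ u' u)

/-- Wires of the gadget. -/
def rargs : (l : RΛ m) → Fin (rfn l).1 → RWire m
  | .one => Fin.elim0
  | .free _ => Fin.elim0
  | .ane _ _ => Fin.elim0
  | .e u a => ![Sum.inl (u, a), Sum.inl (a, u)]
  | .adj u a => ![Sum.inr (.ane u a), Sum.inr (.e u a)]
  | .nadj u a => ![Sum.inr (.adj u a)]
  | .both u u' a => ![Sum.inr (.adj u a), Sum.inr (.adj u' a)]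
  | .neither u u' a => ![Sum.inr (.nadj u a), Sum.inr (.nadj u' a)]
  | .xnor u u' a => ![Sum.inr (.both u u' a), Sum.inr (.neither u u' a)]
  | .hieq u u' a => fun a' => Sum.inr (if IsAnch m a ∧ a < a' then .xnor u u' a' else .one)
  | .wit u' u a => ![Sum.inr (.adj u a), Sum.inr (.nadj u' a), Sum.inr (.hieq u u' a)]
  | .lt u' u => fun a => Sum.inr (.wit u' u a)
  | .r k u => rPrev u k
  | .step k u' u => ![Sum.inr (.free u'), Sum.inr (.lt u' u), Sum.inr (.r k.castSucc u')]
  | .nr i u => ![Sum.inr (.r i.succ u)]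
  | .eqrank i u => ![Sum.inr (.r i.castSucc u), Sum.inr (.nr i u)]

/-- Layers: wires go down. -/
def rlayer : RΛ m → ℕ
  | .one => 0
  | .free _ => 0
  | .ane _ _ => 0
  | .e _ _ => 0
  | .adj _ _ => 1
  | .nadj _ _ => 2
  | .both _ _ _ => 2
  | .neither _ _ _ => 3
  | .xnor _ _ _ => 4
  | .hieq _ _ _ => 5
  | .wit _ _ _ => 6
  | .lt _ _ => 7
  | .r k _ => 8 + 2 * k
  | .step k _ _ => 9 + 2 * k
  | .nr _ _ => 2 * gOf m + 11
  | .eqrank _ _ => 2 * gOf m + 12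

/-- All gate functions of the gadget are in `acBasis`. -/
theorem rfn_mem_acBasis (l : RΛ m) : rfn l ∈ acBasis := by
  cases l with
  | one => exact and_mem_acBasis _
  | free => exact const_mem_acBasis _
  | ane => exact const_mem_acBasis _
  | e => exact or_mem_acBasis _
  | adj => exact and_mem_acBasis _
  | nadj => exact mem_acBasis_not
  | both => exact and_mem_acBasis _
  | neither => exact and_mem_acBasis _
  | xnor => exact or_mem_acBasis _
  | hieq => exact and_mem_acBasis _
  | wit => exact and_mem_acBasis _
  | lt => exact or_mem_acBasis _
  | r => exact or_mem_acBasis _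
  | step => exact and_mem_acBasis _
  | nr => exact mem_acBasis_not
  | eqrank => exact and_mem_acBasis _

/-- Gate wires point to lower layers. -/
theorem rlayer_lt_of_rargs {l l' : RΛ m} {a : Fin (rfn l).1} (h : rargs l a = Sum.inr l') :
    rlayer l' < rlayer l := by
  cases l with
  | one => exact a.elim0
  | free => exact a.elim0
  | ane => exact a.elim0
  | e u b =>
    exfalso; revert h
    refine Fin.cases ?_ (Fin.cases ?_ (fun i => i.elim0)) a <;> simp [rargs]
  | adj u b =>
    revert h
    refine Fin.cases ?_ (Fin.cases ?_ (fun i => i.elim0)) a <;> simp [rargs] <;>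
      rintro rfl <;> simp only [rlayer] <;> omega
  | nadj u b =>
    revert h
    refine Fin.cases ?_ (fun i => i.elim0) a
    simp [rargs]; rintro rfl; simp only [rlayer]; omega
  | both u u' b =>
    revert h
    refine Fin.cases ?_ (Fin.cases ?_ (fun i => i.elim0)) a <;> simp [rargs] <;>
      rintro rfl <;> simp only [rlayer] <;> omega
  | neither u u' b =>
    revert h
    refine Fin.cases ?_ (Fin.cases ?_ (fun i => i.elim0)) a <;> simp [rargs] <;>
      rintro rfl <;> simp only [rlayer] <;> omega
  | xnor u u' b =>
    revert h
    refine Fin.cases ?_ (Fin.cases ?_ (fun i => i.elim0)) a <;> simp [rargs] <;>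
      rintro rfl <;> simp only [rlayer] <;> omega
  | hieq u u' b =>
    simp only [rargs, Sum.inr.injEq] at h
    subst h
    split <;> simp only [rlayer] <;> omega
  | wit u' u b =>
    revert h
    refine Fin.cases ?_ (Fin.cases ?_ (Fin.cases ?_ (fun i => i.elim0))) a <;> simp [rargs] <;>
      rintro rfl <;> simp only [rlayer] <;> omega
  | lt u' u =>
    simp only [rargs, Sum.inr.injEq] at h
    subst h; simp only [rlayer]; omega
  | r k u =>
    rcases k with ⟨_ | k, hk⟩
    · simp only [rargs, rPrev] at h
      cases h; simp only [rlayer]; omega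
    · simp only [rargs, rPrev] at h
      cases h; simp only [rlayer]; omega
  | step k u' u =>
    revert h
    refine Fin.cases ?_ (Fin.cases ?_ (Fin.cases ?_ (fun i => i.elim0))) a <;> simp [rargs] <;>
      rintro rfl <;> simp only [rlayer, Fin.val_castSucc] <;> omega
  | nr i u =>
    revert h
    refine Fin.cases ?_ (fun i => i.elim0) a
    simp [rargs]; rintro rfl; simp only [rlayer, Fin.val_succ]; omega
  | eqrank i u =>
    revert h
    refine Fin.cases ?_ (Fin.cases ?_ (fun i => i.elim0)) a <;> simp [rargs] <;>
      rintro rfl <;> simp only [rlayer, Fin.val_castSucc] <;> omega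

/-- The child relation of the gadget is well founded (acyclicity). -/
theorem rargs_wf (m : ℕ) : WellFounded fun l' l : RΛ m => ∃ a, rargs l a = Sum.inr l' :=
  Subrelation.wf (fun ⟨_, h⟩ => rlayer_lt_of_rargs h) (InvImage.wf rlayer wellFounded_lt)

/-! ### Semantics -/

/-- The explicit semantics of the gadget gates. -/
def rsem (m : ℕ) (x : Fin m × Fin m → Bool) : RΛ m → Bool
  | .one => true
  | .free u => decide (¬ IsAnch m u)
  | .ane u a => decide (IsAnch m a ∧ u ≠ a)
  | .e u a => x (u, a) || x (a, u)
  | .adj u a => decide (a ∈ cls m x u)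
  | .nadj u a => decide (a ∉ cls m x u)
  | .both u u' a => decide (a ∈ cls m x u ∧ a ∈ cls m x u')
  | .neither u u' a => decide (a ∉ cls m x u ∧ a ∉ cls m x u')
  | .xnor u u' a => decide (a ∈ cls m x u ↔ a ∈ cls m x u')
  | .hieq u u' a =>
      decide (∀ a', IsAnch m a → a < a' → (a' ∈ cls m x u ↔ a' ∈ cls m x u'))
  | .wit u' u a =>
      decide (a ∈ cls m x u ∧ a ∉ cls m x u' ∧
        ∀ a', a < a' → (a' ∈ cls m x u ↔ a' ∈ cls m x u'))
  | .lt u' u => decide (key m (cls m x u') < key m (cls m x u))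
  | .r k u => decide ((k : ℕ) ≤ rk m x u)
  | .step k u' u =>
      decide (¬ IsAnch m u' ∧ key m (cls m x u') < key m (cls m x u) ∧ (k : ℕ) ≤ rk m x u')
  | .nr i u => decide (rk m x u < (i : ℕ) + 1)
  | .eqrank i u => decide (rk m x u = (i : ℕ))

section Sem

variable (x : Fin m × Fin m → Bool)

/-- Meaning of `adj`. -/
theorem rsem_adj (u a : Fin m) : rsem m x (.adj u a) = decide (a ∈ cls m x u) := rfl

/-- Meaning of `free`. -/
theorem rsem_free (u : Fin m) : rsem m x (.free u) = decide (u ∈ freeSet m) := by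
  simp [rsem, mem_freeSet_iff]

/-- Meaning of `lt`. -/
theorem rsem_lt (u' u : Fin m) :
    rsem m x (.lt u' u) = decide (key m (cls m x u') < key m (cls m x u)) := rfl

/-- Meaning of `r`. -/
theorem rsem_r (k : Fin (gOf m + 1)) (u : Fin m) :
    rsem m x (.r k u) = decide ((k : ℕ) ≤ rk m x u) := rfl

/-- Meaning of `eqrank`. -/
theorem rsem_eqrank (i : Fin (gOf m)) (u : Fin m) :
    rsem m x (.eqrank i u) = decide (rk m x u = (i : ℕ)) := rfl

/-- **The gate equations**: the explicit semantics is a solution of the gadget's equations. -/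
theorem rsem_eq (l : RΛ m) :
    rsem m x l = (rfn l).2 fun a => Sum.elim x (rsem m x) (rargs l a) := by
  cases l with
  | one => simp [rsem, rfn, GateFn.and]
  | free u => rfl
  | ane u a => rfl
  | e u a => simp [rsem, rfn, rargs, GateFn.or, Fin.exists_fin_two]
  | adj u a =>
    simp only [rsem, rfn, rargs, GateFn.and, Fin.forall_fin_two, Matrix.cons_val_zero,
      Matrix.cons_val_one, Sum.elim_inr, mem_cls_iff]
    by_cases h1 : IsAnch m a <;> by_cases h2 : u = a <;> simp [h1, h2]
  | nadj u a => simp [rsem, rfn, rargs, GateFn.not]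
  | both u u' a => simp [rsem, rfn, rargs, GateFn.and, Fin.forall_fin_two]
  | neither u u' a => simp [rsem, rfn, rargs, GateFn.and, Fin.forall_fin_two]
  | xnor u u' a =>
    simp only [rsem, rfn, rargs, GateFn.or, Fin.exists_fin_two, Matrix.cons_val_zero,
      Matrix.cons_val_one, Sum.elim_inr]
    by_cases h1 : a ∈ cls m x u <;> by_cases h2 : a ∈ cls m x u' <;> simp [h1, h2]
  | hieq u u' a =>
    show decide _ =
      decide (∀ a', rsem m x (if IsAnch m a ∧ a < a' then .xnor u u' a' else .one) = true)
    refine decide_eq_decide.2 (forall_congr' fun a' => ?_)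
    by_cases hc : IsAnch m a ∧ a < a'
    · rw [if_pos hc]
      simp only [rsem, decide_eq_true_eq]
      exact ⟨fun h => h hc.1 hc.2, fun h _ _ => h⟩
    · rw [if_neg hc]
      simp only [rsem, iff_true]
      exact fun h1 h2 => absurd ⟨h1, h2⟩ hc
  | wit u' u a =>
    simp only [rsem, rfn, rargs, GateFn.and, Fin.forall_fin_succ, IsEmpty.forall_iff,
      Matrix.cons_val_zero, Matrix.cons_val_succ, Sum.elim_inr, and_true, decide_eq_true_eq,
      decide_not]
    rw [Bool.eq_iff_iff]
    simp only [decide_eq_true_eq, Bool.not_eq_true', decide_eq_false_iff_not]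
    constructor
    · rintro ⟨h1, h2, h3⟩; exact ⟨h1, h2, fun a' _ h => h3 a' h⟩
    · rintro ⟨h1, h2, h3⟩; exact ⟨h1, h2, fun a' h => h3 a' (isAnch_of_mem_cls h1) h⟩
  | lt u' u =>
    simp only [rsem, rfn, rargs, GateFn.or, Sum.elim_inr, decide_eq_true_eq, key_lt_key_iff]
  | r k u =>
    rcases k with ⟨_ | k, hk⟩
    · simp only [rsem, rfn, rargs, rPrev, GateFn.or, Sum.elim_inr, zero_le, decide_true]
      rw [eq_comm, decide_eq_true_iff]
      exact ⟨u, trivial⟩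
    · simp only [rsem, rfn, rargs, rPrev, GateFn.or, Sum.elim_inr]
      rw [Bool.eq_iff_iff]
      simp only [decide_eq_true_eq, succ_le_rk_iff, mem_freeSet_iff]
  | step k u' u =>
    simp only [rsem, rfn, rargs, GateFn.and, Fin.forall_fin_succ, IsEmpty.forall_iff,
      Matrix.cons_val_zero, Matrix.cons_val_succ, Sum.elim_inr, and_true, Fin.val_castSucc]
    rw [Bool.eq_iff_iff]
    simp only [decide_eq_true_eq, decide_not, Bool.not_eq_true', decide_eq_false_iff_not]
  | nr i u =>
    simp only [rsem, rfn, rargs, GateFn.not, Matrix.cons_val_zero, Sum.elim_inr, Fin.val_succ]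
    rw [Bool.eq_iff_iff]
    simp only [decide_eq_true_eq, Bool.not_eq_true', decide_eq_false_iff_not, not_le]
  | eqrank i u =>
    simp only [rsem, rfn, rargs, GateFn.and, Fin.forall_fin_two, Matrix.cons_val_zero,
      Matrix.cons_val_one, Sum.elim_inr, Fin.val_castSucc]
    rw [Bool.eq_iff_iff]
    simp only [decide_eq_true_eq]
    omega

end Sem

/-- **The gate equations characterise the semantics**: any assignment of values to the gadget
gates satisfying the gate equations (e.g. `D.val x` restricted to an embedded copy of the gadget
in a `GateDAG` `D`) is `rsem m x`. -/
theorem eq_rsem (x : Fin m × Fin m → Bool) {w : RΛ m → Bool}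
    (h : ∀ l, w l = (rfn l).2 fun a => Sum.elim x w (rargs l a)) : w = rsem m x := by
  funext l
  induction l using (rargs_wf m).induction with
  | _ l ih =>
    rw [h, rsem_eq]
    refine congrArg (rfn l).2 (funext fun a => ?_)
    cases hq : rargs l a with
    | inl q => rfl
    | inr l' => exact ih l' ⟨a, hq⟩

end SymA

end Summit.PneNP.PneNP.Theorems.HamCompilesKC
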